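import Summits.NavierStokesRegularity.FluidComputer.GateBudgetLadderSwing
import Summits.NavierStokesRegularity.FluidComputer.GateBudgetDudHorizonSharp
import HarnessLib

/-!
# GateBudget part 108 — the clean dud horizon at k = 1 with the swing-priced rung (§290)

Cell `pub-fluidc`, blueprint seat bp1 (gen 39, SPEC-INPUT-bp1 §CD(3)(b)); namespace
`Summit.NavierStokesRegularity.FluidComputer.GateBudget`, headline member
`RotorKnob.rotorCircuit K K¹⁰ ε ρ` of the two-scale family from `delayInit` (5.6), `K ≥ 16`,
`ε² ≤ 1/(6K²⁰)`, on the UNIT LATTICE `ε = K¹⁰ρ²` (`k = 1`); modes `0 = a` (carrier), `1 = b`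
(clock), `2 = c` (trigger), `3 = d` (transfer), `4 = ã` (output). HONEST FRAMING: a low prior,
high value-of-information experiment on Tao's machine paradigm; NOT a claim that NS blows up.

WHAT. Part 98 §273 is the clean dud horizon on the √P pair ledger with part 90's output gain
`U = 7/2 + k²/3 + 10⁻³` per rung: `ã ≤ 0.1415` on `[0, 1.8282 + N]` for every `N ≥ 1` in the
√-window `(N - 1)(7/2 + k²/3 + 10⁻³)/K⁹ + (14k + 127) log N/(5K⁴) ≤ 0.1409` (`N - 1 ≤ 0.0343K⁹`
at `k = 1`, `K = 16`). §290 is part 98 LINE BY LINE at `k = 1` on part 107 §289's ladder,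
whose rung is priced by part 106's swing ceiling, with the output ledger `U = 2` (§290a: `1.57 +
1/3 + 3.33(D + D²) + 520 log K·D² ≤ 1.9038 ≤ 2` on part 86's `D = 7/K⁴`):
`knob_misfire_ladder_swing` — for every `N` in the √-WINDOW `(N - 1)·2/K⁹ + (14k + 127) log
N/(5K⁴) ≤ 0.1409` (`k = 1`: `141 log N/(5K⁴)`) and every `1 ≤ n ≤ N` a normal-form ignition
`rₙ > 1.8282 + n` with `5/4 ≤ θₙ ≤ 29/20`, `√P(rₙ) ≤ 7/K⁴ + (n - 1)·2/K⁹ + (14k + 127) log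
n/(5K⁴)`, `P(rₙ) ≤ 1/50`, `(n - 1)/K⁹ ≤ ã(rₙ) ≤ 0.1415`, `|d(rₙ)| ≤ 7/K⁴`;
`knob_ladder_no_output_swing` — `ã ≤ 0.1415` on `[0, 1.8282 + N]` under `ε = K¹⁰ρ²` and `(N -
1)·2/K⁹ + 141 log N/(5K⁴) ≤ 0.1409`; `knob_ladder_no_output_swing_explicit` — the same under the
log-free window `(N - 1)·2/K⁹ + 9·141 log K/(5K⁴) ≤ 0.1409`.
NUMBERS (`K = 16`, `k = 1`): `N - 1 ≤ 0.0656K⁹ = 4.51·10⁹` clean rungs (log-free form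
`0.0650K⁹`), against part 98's `0.0343K⁹` (×1.91), part 95's `0.01658K⁹` (×3.96) and part 72's
forced ceiling `0.1415K⁹ + 1` — a factor `2.16` (was `4.1`); `0.07045K⁹ = 0.1409K⁹/2` as `K →
∞` (factor `2.0`). The remaining factor is bookkeeping: the priced `1.57 + 1/3` rounded to `U =
2` against the method's `≈ 1.55a²/θ` per rung, and the unpriced floor side (`1/K⁹` per rung on
the necessity side, part 72, against the same `≈ 1.55/K⁹`).
HOW. Part 98's proof with: `U = 2` certified by §290a in place of `two_sided_numerics`' `U`-
conjunct; part 107 §289 `knob_ladder_swing` in place of part 97's `knob_ladder_pair`; the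
lattice window, `k ≤ K²` derived from `k = 1` (part 106 §288a); `N - 1 ≤ K⁹` read off the
window directly (`2(N - 1) ≤ 0.1409K⁹`); everything else (anchor part 86, `δ₀`, the closed-form
√-window part 96 §271, sharp loss part 89, output monotonicity) VERBATIM.
HONEST LIMITS. (i) `k = 1` only (parts 99–107); (ii) the horizon is still PAIR-limited and the
factor `≈ 2` to part 72's ceiling is NOT closed here; (iii) existence of the rungs, no
uniqueness; (iv) nothing about Navier–Stokes.
[cite: Tao2016AveragedNS, §5.5 Theorem 5.3, (5.5), (5.6), (b-eq), (c-eq), (d-eq), (ta-eq),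
(energy-con), (est)]
-/

noncomputable section

namespace Summit.NavierStokesRegularity.FluidComputer.GateBudget

open Real Set Filter Topology
open Literature.Analysis.FluidPDE.Tao2016AveragedNS

variable {K ε ρ : ℝ} {X : ℝ → Fin 5 → ℝ} {C : ℝ → ℝ}

/-! ## §290a The swing ledger on part 86's transfer ledger -/

/-- §290a SWING-LEDGER NUMERICS (`K ≥ 16`, `D = 7/K⁴`): `1.57 + 1/3 + 3.33(D + D²) + 520 log K·D²
≤ 2` (`≈ 1.9037` at `K = 16`; `log K ≤ K`). [numerics] -/
theorem swing_ledger_numerics (hK : 16 ≤ K) :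
    157 / 100 + 1 / 3 + 333 / 100 * (7 / K ^ 4 + (7 / K ^ 4) ^ 2)
      + 520 * log K * (7 / K ^ 4) ^ 2 ≤ 2 := by
  have hK0 : (0 : ℝ) < K := by linarith
  have hK4 : (16 : ℝ) ^ 4 ≤ K ^ 4 := pow_le_pow_left₀ (by norm_num) hK 4
  have hK7 : (16 : ℝ) ^ 7 ≤ K ^ 7 := pow_le_pow_left₀ (by norm_num) hK 7
  have hD : 7 / K ^ 4 ≤ 7 / 16 ^ 4 := div_le_div_of_nonneg_left (by norm_num) (by norm_num) hK4
  have hD0 : (0 : ℝ) ≤ 7 / K ^ 4 := by positivity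
  have hD2 : (7 / K ^ 4) ^ 2 ≤ (7 / 16 ^ 4) ^ 2 := pow_le_pow_left₀ hD0 hD 2
  have hlog : log K ≤ K := (Real.log_le_sub_one_of_pos hK0).trans (by linarith)
  have hL : 520 * log K * (7 / K ^ 4) ^ 2 ≤ 25480 / K ^ 7 := by
    have e : 520 * K * (7 / K ^ 4) ^ 2 = 25480 / K ^ 7 := by field_simp; ring
    rw [← e]
    exact mul_le_mul_of_nonneg_right (by linarith only [hlog]) (sq_nonneg _)
  have h7 : 25480 / K ^ 7 ≤ 25480 / 16 ^ 7 :=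
    div_le_div_of_nonneg_left (by norm_num) (by norm_num) hK7
  norm_num at hD hD2 h7 ⊢
  linarith only [hD, hD2, hL, h7]

/-! ## §290 The misfire ladder inside the √-window, U = 2 -/

/-- §290 **THE MISFIRE LADDER AT EVERY WINDING, k = 1, SWING-PRICED RUNG** (headline member from
`delayInit` with a trigger primitive, `K ≥ 16`, `0 < ε`, `ε² ≤ 1/(6K²⁰)`, `0 < ρ`, `ε = kK¹⁰ρ²`
with `k = 1`): for every `N` in the √-window `(N - 1)·2/K⁹ + (14k + 127) log N/(5K⁴) ≤ 0.1409`
and every `1 ≤ n ≤ N` there is a normal-form ignition `rₙ > 1.8282 + n` with `5/4 ≤ θₙ ≤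
29/20`, `√P(rₙ) ≤ 7/K⁴ + (n - 1)·2/K⁹ + (14k + 127) log n/(5K⁴)`, `P(rₙ) ≤ 1/50`, `(n - 1)/K⁹
≤ ã(rₙ) ≤ 0.1415`, `|d(rₙ)| ≤ 7/K⁴`. [derived: part 107 §289, §290a, part 98 §273, part 96
§271, part 86 §241–§242, part 85 §250, part 89 §258, part 106 §288a] -/
theorem knob_misfire_ladder_swing
    (hX : ∀ t, HasDerivAt X (RotorKnob.rotorCircuit K (K ^ 10) ε ρ (X t)) t)
    (h0 : X 0 = delayInit) (hC : ∀ t, HasDerivAt C (X t 2) t) (hK : 16 ≤ K)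
    (hε : 0 < ε) (hεK : ε ^ 2 ≤ 1 / (6 * K ^ 20)) (hρ : 0 < ρ) (k : ℕ)
    (hk : ε = k * K ^ 10 * ρ ^ 2) (hkone : k = 1) (N : ℕ)
    (hNW : ((N : ℝ) - 1) * (2 / K ^ 9) + (14 * k + 127) / (5 * K ^ 4) * log N ≤ 1409 / 10000) :
    ∀ n : ℕ, 1 ≤ n → n ≤ N → ∃ r θ : ℝ, 18282 / 10000 + n < r ∧ X r 1 = θ * ε ∧
      5 / 4 ≤ θ ∧ θ ≤ 29 / 20 ∧ X r 2 = ρ ^ 2 / K ^ 9 ∧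
      √(X r 3 ^ 2 + X r 4 ^ 2)
        ≤ 7 / K ^ 4 + ((n : ℝ) - 1) * (2 / K ^ 9) + (14 * k + 127) / (5 * K ^ 4) * log n ∧
      X r 3 ^ 2 + X r 4 ^ 2 ≤ 1 / 50 ∧
      ((n : ℝ) - 1) / K ^ 9 ≤ X r 4 ∧ X r 4 ≤ 1415 / 10000 ∧ |X r 3| ≤ 7 / K ^ 4 := by
  have hkR : (k : ℝ) = 1 := by exact_mod_cast hkone
  have hlat : ε = K ^ 10 * ρ ^ 2 := by rw [hk, hkR, one_mul]
  obtain ⟨hlo, hhi, -, -, -, -, -⟩ := unit_lattice_numerics hK hlat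
  have hkK : (k : ℝ) ≤ K ^ 2 := by rw [hkR]; nlinarith only [hK]
  obtain ⟨r₁, θ₁, hr1, hb1, hθlo, hθhi, hc1, he0, hP1, hd1, hk1⟩ :=
    knob_ladder_anchor_member hX h0 hC hK hε hεK hρ hlo hhi k hk
  obtain ⟨hD, -, -, -, hres⟩ := two_sided_numerics hK hk1 hkK
  have hU := swing_ledger_numerics hK
  have hS := clock_slip_numerics hK hk1 hkK
  obtain ⟨hL0, hL42⟩ := sharp_loss_numerics hK hk1 hkK
  obtain ⟨hcL, hwin⟩ := pair_ledger_numerics hK hk1 hkK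
  have hK0 : (0 : ℝ) < K := by linarith
  have hK4 : (0 : ℝ) < K ^ 4 := by positivity
  have hK9 : (0 : ℝ) < K ^ 9 := by positivity
  have hk0 : (0 : ℝ) ≤ k := Nat.cast_nonneg k
  obtain ⟨e₁, he₁_def⟩ : ∃ e₁ : ℝ,
      e₁ = k * π / (49 / 100 * K ^ 10 - 1) + 2 / K ^ 10 + 245 / K ^ 8 := ⟨_, rfl⟩
  obtain ⟨δ₀, hδ₀_def⟩ : ∃ δ₀ : ℝ,
      δ₀ = (2 * (7 / K ^ 4) + (2 * k + 3) / (5 * K ^ 9)) * ((2 * k + 3) / (5 * K ^ 9))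
        + 6 * (7 / K ^ 4 + (2 * k + 3) / (5 * K ^ 9) + 3 / K ^ 9) / K ^ 9 := ⟨_, rfl⟩
  obtain ⟨u, hu_def⟩ : ∃ u : ℝ, u = 2 / K ^ 9 := ⟨_, rfl⟩
  obtain ⟨cM, hcM_def⟩ : ∃ cM : ℝ, cM = (14 * k + 127) / (5 * K ^ 4) := ⟨_, rfl⟩
  rw [← he₁_def] at hP1 hd1 hD hres
  rw [← hδ₀_def] at hcL
  have he₁0 : 0 ≤ e₁ := (abs_nonneg _).trans hd1
  have hsq₁ : √(e₁ ^ 2) = e₁ := Real.sqrt_sq he₁0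
  have he₁7 : e₁ ≤ 7 / K ^ 4 := by
    have hJ : 0 ≤ (1 + 10 / 9 * K ^ 4) * ((61 / 12 * k + 2 / 3) / K ^ 10 + 3 / K ^ 9) := by
      positivity
    linarith only [hD, hJ]
  have hu0 : 0 ≤ u := by rw [hu_def]; positivity
  have hδ₀0 : 0 ≤ δ₀ := by rw [hδ₀_def]; positivity
  have hδS : δ₀ ≤ (11 / 10 + k ^ 2 / 10) / K ^ 9 := by
    have h0 : 0 ≤ (2829 / 10000 + (7 / 2 + k ^ 2 / 3 + 1 / 1000) / K ^ 9)
        * ((7 / 2 + k ^ 2 / 3 + 1 / 1000) / K ^ 9) := by positivity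
    rw [hδ₀_def]; linarith only [hS, h0]
  have hcM0 : 0 ≤ cM := by rw [hcM_def]; positivity
  have hθ₀lo : 139 / 100 - (242 * log K / K ^ 10
        + 37 * (7 / K ^ 4 + (2 * k + 3) / (5 * K ^ 9) + 4 / K ^ 9) / K ^ 9) ≤ θ₁ := by
    linarith only [hL0, hθlo]
  simp only [← hu_def, ← hcM_def] at hNW hcL ⊢
  intro n hn hnN
  have hn1 : (1 : ℝ) ≤ n := by exact_mod_cast hn
  have hN1 : (1 : ℝ) ≤ N := by exact_mod_cast hn.trans hnN
  have hlogN : 0 ≤ log (N : ℝ) := Real.log_nonneg hN1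
  have hlogn : 0 ≤ log (n : ℝ) := Real.log_nonneg hn1
  have hcMN : 0 ≤ cM * log N := mul_nonneg hcM0 hlogN
  -- `N - 1 ≤ K⁹` from the √-window: `2(N - 1) ≤ 0.1409K⁹`
  have hN9 : (N : ℝ) - 1 ≤ K ^ 9 := by
    have h : ((N : ℝ) - 1) * u ≤ 1409 / 10000 := by linarith only [hNW, hcMN]
    rw [hu_def, ← mul_div_assoc, div_le_iff₀ hK9] at h
    linarith only [h, hK9.le]
  -- the √-window of part 97 §272 from the closed-form one (part 96 §271)
  have hcLN : δ₀ * K ^ 9 / 2 * log N ≤ cM * log N := mul_le_mul_of_nonneg_right hcL hlogN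
  have hW0 : 0 ≤ √(e₁ ^ 2) + ((N : ℝ) - 1) * u + δ₀ * K ^ 9 / 2 * log N := by
    rw [hsq₁]
    have h1 : 0 ≤ ((N : ℝ) - 1) * u := mul_nonneg (by linarith only [hN1]) hu0
    have h2 : 0 ≤ δ₀ * K ^ 9 / 2 * log N := mul_nonneg (by positivity) hlogN
    linarith only [he₁0, h1, h2]
  have hWle : √(e₁ ^ 2) + ((N : ℝ) - 1) * u + δ₀ * K ^ 9 / 2 * log N
      ≤ 7 / K ^ 4 + 1409 / 10000 := by
    rw [hsq₁]; linarith only [he₁7, hNW, hcLN]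
  have hW2 := pow_le_pow_left₀ hW0 hWle 2
  have hNW' : (√(e₁ ^ 2) + ((N : ℝ) - 1) * u + δ₀ * K ^ 9 / 2 * log N) ^ 2
      + (3 * (k * π / ((25 / 16 - 1 / 10 ^ 6) * K ^ 10 - 1) + 1 / K ^ 19
        + 310 * log K / K ^ 9) / 10 + 6 / K ^ 9) + δ₀ ≤ 1 / 50 := by
    nlinarith only [hW2, hres, sq_nonneg e₁, hδS, hwin]
  obtain ⟨r, θ, hr, hb, hθ1, hθ2, hc, hW, hP50, hA, ha, hd⟩ := knob_ladder_swing hX h0 hC hK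
    hε hεK hρ hlo hhi k hk hkone (le_of_lt (by linarith only [hr1])) hb1 hc1 hP1 hθ₀lo
    (by linarith only [hθhi]) hL42 hN9 le_rfl he0 hd1 hD hU le_rfl (le_of_eq hδ₀_def.symm)
    le_rfl (by rw [← hu_def]; exact hNW') n hn hnN
  refine ⟨r, θ, by linarith only [hr, hr1], hb, hθ1, hθ2, hc, ?_, hP50, by simpa using hA, ha,
    by linarith only [hd, he₁7]⟩
  have hcLn : δ₀ * K ^ 9 / 2 * log n ≤ cM * log n := mul_le_mul_of_nonneg_right hcL hlogn
  rw [hsq₁, ← hu_def] at hW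
  linarith only [hW, he₁7, hcLn]

/-- §290 **NO OUTPUT INSIDE THE √-WINDOW, k = 1, SWING-PRICED RUNG** (headline member, `K ≥ 16`,
`ε² ≤ 1/(6K²⁰)`, unit lattice `ε = K¹⁰ρ²`, any `N ≥ 1` with `(N - 1)·2/K⁹ + 141 log N/(5K⁴) ≤
0.1409`): `ã(t) ≤ 0.1415` for all `t ∈ [0, 1.8282 + N]` — the machine misfires cleanly for
`0.0656K⁹` windings (`K = 16`; `0.07045K⁹` as `K → ∞`), against part 98 §273's `0.0343K⁹`, and
never delivers. [derived: this file §290, part 106 §288a, part 9] -/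
theorem knob_ladder_no_output_swing
    (hX : ∀ t, HasDerivAt X (RotorKnob.rotorCircuit K (K ^ 10) ε ρ (X t)) t)
    (h0 : X 0 = delayInit) (hC : ∀ t, HasDerivAt C (X t 2) t) (hK : 16 ≤ K)
    (hε : 0 < ε) (hεK : ε ^ 2 ≤ 1 / (6 * K ^ 20)) (hρ : 0 < ρ) (hlat : ε = K ^ 10 * ρ ^ 2)
    (N : ℕ) (hN1 : 1 ≤ N)
    (hNW : ((N : ℝ) - 1) * (2 / K ^ 9) + 141 / (5 * K ^ 4) * log N ≤ 1409 / 10000) :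
    ∀ t ∈ Icc (0 : ℝ) (18282 / 10000 + N), X t 4 ≤ 1415 / 10000 := by
  have hK0 : (0 : ℝ) < K := by linarith
  obtain ⟨-, -, hk, -, -, -, -⟩ := unit_lattice_numerics hK hlat
  have e : (14 * ((1 : ℕ) : ℝ) + 127) / (5 * K ^ 4) = 141 / (5 * K ^ 4) := by norm_num
  obtain ⟨r, θ, hr, -, -, -, -, -, -, -, ha, -⟩ :=
    knob_misfire_ladder_swing hX h0 hC hK hε hεK hρ 1 hk rfl N (by rw [e]; exact hNW) N hN1 le_rfl
  intro t ht
  exact (RotorKnob.rotorCircuit_output_monotone hK0.le hX (by linarith only [ht.2, hr])).trans ha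

/-- §290 **NO OUTPUT INSIDE THE LOG-FREE √-WINDOW, k = 1, SWING-PRICED RUNG** (headline member,
`K ≥ 16`, `ε² ≤ 1/(6K²⁰)`, unit lattice `ε = K¹⁰ρ²`, any `N ≥ 1` with `(N - 1)·2/K⁹ + 9·141 log
K/(5K⁴) ≤ 0.1409`): `ã(t) ≤ 0.1415` for all `t ∈ [0, 1.8282 + N]` (the window forces `N ≤ K⁹`,
so `log N ≤ 9 log K`). At `K = 16`: `N - 1 ≤ 0.0650K⁹ = 4.47·10⁹`, against part 98's
`0.0339K⁹`. [derived: this file §290] -/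
theorem knob_ladder_no_output_swing_explicit
    (hX : ∀ t, HasDerivAt X (RotorKnob.rotorCircuit K (K ^ 10) ε ρ (X t)) t)
    (h0 : X 0 = delayInit) (hC : ∀ t, HasDerivAt C (X t 2) t) (hK : 16 ≤ K)
    (hε : 0 < ε) (hεK : ε ^ 2 ≤ 1 / (6 * K ^ 20)) (hρ : 0 < ρ) (hlat : ε = K ^ 10 * ρ ^ 2)
    (N : ℕ) (hN1 : 1 ≤ N)
    (hNL : ((N : ℝ) - 1) * (2 / K ^ 9) + 141 / (5 * K ^ 4) * (9 * log K) ≤ 1409 / 10000) :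
    ∀ t ∈ Icc (0 : ℝ) (18282 / 10000 + N), X t 4 ≤ 1415 / 10000 := by
  have hK0 : (0 : ℝ) < K := by linarith
  have hK9 : (0 : ℝ) < K ^ 9 := by positivity
  have hN1' : (1 : ℝ) ≤ N := by exact_mod_cast hN1
  have hcM0 : (0 : ℝ) ≤ 141 / (5 * K ^ 4) := by positivity
  have hlogK : 0 ≤ log K := Real.log_nonneg (by linarith)
  have hNu : ((N : ℝ) - 1) * (2 / K ^ 9) ≤ 15 / 100 := by
    have := mul_nonneg hcM0 (mul_nonneg (by norm_num : (0 : ℝ) ≤ 9) hlogK)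
    linarith only [hNL, this]
  have hN9 : (N : ℝ) - 1 ≤ 15 / 100 * K ^ 9 := by
    have h1 : (1 : ℝ) / K ^ 9 ≤ 2 / K ^ 9 := div_le_div_of_nonneg_right (by norm_num) hK9.le
    have h2 := mul_le_mul_of_nonneg_left h1 (by linarith only [hN1'] : (0 : ℝ) ≤ (N : ℝ) - 1)
    have h3 : ((N : ℝ) - 1) * (1 / K ^ 9) ≤ 15 / 100 := h2.trans hNu
    rw [mul_one_div, div_le_iff₀ hK9] at h3
    exact h3
  have hK9big : (68719476736 : ℝ) ≤ K ^ 9 := by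
    have := pow_le_pow_left₀ (by norm_num : (0 : ℝ) ≤ 16) hK 9; norm_num at this; exact this
  have hNK : (N : ℝ) ≤ K ^ 9 := by linarith only [hN9, hK9big]
  have hlogN : log (N : ℝ) ≤ 9 * log K := by
    have h := Real.log_le_log (by linarith only [hN1']) hNK
    have h9 : log (K ^ 9) = 9 * log K := by rw [Real.log_pow]; norm_num
    linarith only [h, h9]
  have hNW : ((N : ℝ) - 1) * (2 / K ^ 9) + 141 / (5 * K ^ 4) * log N ≤ 1409 / 10000 := by
    have := mul_le_mul_of_nonneg_left hlogN hcM0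
    linarith only [hNL, this]
  exact knob_ladder_no_output_swing hX h0 hC hK hε hεK hρ hlat N hN1 hNW

end Summit.NavierStokesRegularity.FluidComputer.GateBudget

end
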